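/-
Copyright (c) 2026 the pub-hodgecm-mathlib formalisation cell (harness21).  Prover seat hodgecm-mathlib-B-p04 (g47): the «UNIT-TRACE SEED» of the linear symmetriser
(★ `RationalGoodVectorParityUniform`, binders `hω`∕`hωtr`) at an inert-unramified place; 2026-09-02.
-/
import Literature.NumberTheory.LocalFields.UnramifiedQuadraticFixedClassSquare   -- ★ (W3a, this seat): brings the `Valued` residue plumbing (`exists_residueField_ringHom_of_v_eq`, `residueHom_galAdicCompletionMap_eq_pow_valued`, `fintypeCard_valuedResidueField_eq_sq_of_inert`, `residue_eq_zero_iff_v_lt_one`), ★ `exists_frob_ne`, the CM currency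
import HarnessLib

/-!
# A unit of UNIT TRACE at an inert-unramified place: `∃ ω ∈ 𝒪_w^×` with `ω + σ_w ω ∈ 𝒪^×` (Serre, *Local Fields*, Ch. V §2: the residue extension of an unramified
# quadratic extension is separable, so its trace is onto)

Topic `NumberTheory/LocalFields`; namespace `Literature.NumberTheory.LocalFields.UnramifiedQuadraticNorm` (sibling of ★ FILE α ∕ ★ W3a).  THEOREMS ONLY (no definition, no instance,
no notation, no named fact, no `sorry`); count-neutral; kernel lane `--supports stmt-HodgeConjecture-24833`.  Cell `pub/hodgecm-mathlib` (D-0151), crux H413 = `stmt-HodgeConjecture-24833`,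
half A line LH4 (M4 wall); this is the SEED `ω` of the linear symmetriser `ω + σ(ω)·G·X` of ★ `SplitTorusOrderLinearSymmetriser` ∕ ★ `RationalGoodVectorParityUniform` (binders
`hω : |ω| ≤ 1`, `hωtr : |ω + σω| = 1`; B-p04 (g47) memo `MEMO-M4-wild-parity.v1` §2) at the CM place `L_w ∕ L⁺_v`, `v` inert-UNRAMIFIED, ANY residue characteristic.  HONEST LABEL:
HC_CM is proved only modulo the 7 printed citations (2 remaining named inputs: hLiu418 = stmt-HodgeConjecture-24832, h413 = stmt-HodgeConjecture-24833) until rung 0 closes;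
count-neutral (pays no organ, opens no road).

THE MATHEMATICS.  `K` valued with finite residue field `𝓀` of order `q²`, `σ` an isometric endomorphism reducing to `Frob_q` on `𝓀`.  If `char 𝓀 ≠ 2` then `ω = 1` works
(`1 + σ1 = 2` is a unit).  If `char 𝓀 = 2`, pick `x ∈ 𝓀` with `x^q ≠ x` (★ `exists_frob_ne`: `Frob_q ≠ id` on a field of order `q²`) and lift it to `ω ∈ 𝒪`: the residue of
`ω + σω` is `x + x^q = x^q − x ≠ 0`, so `ω + σω` is a unit (and `x ≠ 0`, so `ω` is a unit).  In both cases `|ω| = 1 = |ω + σω|` (§1); §2 docks it at `σ = σ_w`.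

## References
* [Serre1979] J.-P. Serre, *Local Fields*, GTM 67 (1979), Ch. V §2 (unramified extensions: the trace `𝒪_L → 𝒪_K` is surjective), Ch. III §3.
* [NeukirchANT1999] J. Neukirch, *Algebraic Number Theory* (1999), Ch. II (4.3), (5.7).
-/

set_option autoImplicit false

noncomputable section

open scoped Valued WithZero
open NumberField IsDedekindDomain
open Literature.NumberTheory.Automorphic Literature.NumberTheory.Automorphic.UnitaryLatticeTree Literature.NumberTheory.GaloisRepresentations

namespace Literature.NumberTheory.LocalFields.UnramifiedQuadraticNorm

/-! ## §1 Generic: a valued field with residue field of order `q²` and an isometric `σ` reducing to `Frob_q` -/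

section Generic

variable {K : Type*} [Field K] [Valued K ℤᵐ⁰] {σ : K →+* K}

/-- **A UNIT OF UNIT TRACE**: `∃ ω`, `|ω| = 1`, `|ω + σω| = 1` — `ω = 1` when `char 𝓀 ≠ 2`; when `char 𝓀 = 2`, a lift of any `x ∈ 𝓀` moved by `Frob_q` (★ `exists_frob_ne`),
whose trace residue `x + x^q = x^q − x` is non-zero.  The seed of the linear symmetriser of ★ `RationalGoodVectorParityUniform`. [cite: Serre1979, Ch. V §2] [cite: NeukirchANT1999, Ch. II (4.3)] -/
theorem exists_v_eq_one_v_add_map_eq_one [Fintype 𝓀[K]] (hvσ : ∀ x, Valued.v (σ x) = Valued.v x)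
    (σk : 𝓀[K] →+* 𝓀[K]) (hσk : ∀ x : 𝒪[K], IsLocalRing.residue 𝒪[K] ⟨σ x, map_mem_integer_of_v_eq hvσ x⟩ = σk (IsLocalRing.residue 𝒪[K] x))
    {q : ℕ} (hk : Fintype.card 𝓀[K] = q ^ 2) (hσq : ∀ y, σk y = y ^ q) :
    ∃ ω : K, Valued.v ω = 1 ∧ Valued.v (ω + σ ω) = 1 := by
  -- a unit of `𝒪` of non-zero residue has valuation `1`
  have hunit : ∀ X : 𝒪[K], IsLocalRing.residue 𝒪[K] X ≠ 0 → Valued.v (X : K) = 1 := fun X hX =>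
    le_antisymm X.2 (not_lt.1 fun hlt => hX ((residue_eq_zero_iff_v_lt_one X).2 hlt))
  by_cases h2 : (2 : 𝓀[K]) = 0
  · -- characteristic `2`: lift an element moved by `Frob_q`
    obtain ⟨x, hx⟩ := Literature.LinearAlgebra.Matrix.exists_frob_ne hk σk hσq
    obtain ⟨X, hX⟩ := IsLocalRing.residue_surjective x
    have hx0 : x ≠ 0 := fun h0 => hx (by rw [h0, map_zero])
    refine ⟨(X : K), hunit X (by rw [hX]; exact hx0), ?_⟩
    have hmem : (X : K) + σ X ∈ 𝒪[K] := (X + ⟨σ X, map_mem_integer_of_v_eq hvσ X⟩ : 𝒪[K]).2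
    have hres : IsLocalRing.residue 𝒪[K] ⟨(X : K) + σ X, hmem⟩ = x + σk x := by
      rw [← hX, ← hσk X, ← map_add]; rfl
    refine hunit ⟨(X : K) + σ X, hmem⟩ ?_
    rw [hres]
    -- in characteristic `2`: `x + σk x = σk x − x ≠ 0`
    have hneg : ∀ y : 𝓀[K], -y = y := fun y => by
      have : y + y = 0 := by rw [← two_mul, h2, zero_mul]
      exact (neg_eq_of_add_eq_zero_left this)
    intro h0
    apply hx
    have : σk x = -x := eq_neg_of_add_eq_zero_right h0
    rw [this, hneg]
  · -- odd residue characteristic: `ω = 1`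
    refine ⟨1, Valuation.map_one _, ?_⟩
    have h := hunit 2 (by rwa [map_ofNat])
    rw [map_one, one_add_one_eq_two]
    exact_mod_cast h

end Generic

/-! ## §2 The completion `L_w` of a CM field at a place `v` of `L⁺` INERT-UNRAMIFIED in `L` (any residue characteristic) -/

section CM

variable (L : Type) [Field L] [NumberField L] [IsCMField L] (v : HeightOneSpectrum (𝓞 ↥(maximalRealSubfield L)))
  (w : UnitaryGroup.PlacesOver L v) (hw : IsCMField.complexConj L • w.1 = w.1)

include hw in
/-- **UNIT-TRACE SEED AT AN INERT-UNRAMIFIED PLACE**: `∃ ω ∈ L_w` with `|ω|_w = 1` and `|ω + σ_w ω|_w = 1` (`v` unramified in `L`, `σ_L • w = w`; any residue characteristic) —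
the binders `hω`, `hωtr` of ★ `RationalGoodVectorParityUniform.exists_rational_good_of_even_uniform` at the CM place (read in the eigen-field through `j = toPlace`, where `ιω = ω`
is automatic).  ★ §1 docked with `σ̄_w = Frob_{q_v}` (★ `residueHom_galAdicCompletionMap_eq_pow_valued`) and `|𝓀[L_w]| = q_v²` (★ `fintypeCard_valuedResidueField_eq_sq_of_inert`).
[cite: Serre1979, Ch. V §2] [cite: NeukirchANT1999, Ch. II (4.3), (5.7)] -/
theorem exists_v_eq_one_v_add_galAdicCompletionMap_eq_one (hunr : Algebra.IsUnramifiedIn (𝓞 L) v.asIdeal) :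
    ∃ ω : w.1.adicCompletion L, Valued.v ω = 1 ∧ Valued.v (ω + galAdicCompletionMap (L := L) (IsCMField.complexConj L) hw ω) = 1 := by
  haveI : Finite 𝓀[w.1.adicCompletion L] := Literature.NumberTheory.Automorphic.finite_residueField_adicCompletion L w.1
  letI : Fintype 𝓀[w.1.adicCompletion L] := Fintype.ofFinite _
  have hc : IsCMField.complexConj L ≠ 1 := IsCMField.complexConj_ne_one L
  have hvσ : ∀ x, Valued.v (galAdicCompletionMap (L := L) (IsCMField.complexConj L) hw x) = Valued.v x :=
    fun x => valued_galAdicCompletionMap (L := L) (IsCMField.complexConj L) hw x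
  obtain ⟨σk, hσk⟩ := exists_residueField_ringHom_of_v_eq (K := w.1.adicCompletion L) hvσ
  exact exists_v_eq_one_v_add_map_eq_one hvσ σk hσk
    (fintypeCard_valuedResidueField_eq_sq_of_inert (IsCMField.complexConj L) v hc hunr w hw)
    (residueHom_galAdicCompletionMap_eq_pow_valued (IsCMField.complexConj L) v hc hunr w hw σk hσk)

end CM

end Literature.NumberTheory.LocalFields.UnramifiedQuadraticNorm

end
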